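import Summits.AnomalousDissipation.AnomalousDissipation.Theorems.SawtoothPulseCascadeK1LocalisedCascadeKHBlochDuality
import Summits.AnomalousDissipation.AnomalousDissipation.Theorems.SawtoothPulseCascadeK1LocalisedCascadeKHKernelBlochDeriv
import Summits.AnomalousDissipation.AnomalousDissipation.Theorems.SawtoothPulseCascadeK1LocalisedCascadeKHCornerPhase
import Summits.AnomalousDissipation.AnomalousDissipation.Theorems.SawtoothPulseCascadeK1LocalisedCascadeKHTransportCoeff

/-!
# K2 lane (route-2 `SawtoothPulseCascade`, crux dir `K1LocalisedCascade`): the two KINK-PAIR SOURCES of the block at the corner — `H¹` data and the duality bounds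

Helper file of the K2 lane (ACL item stmt-AnomalousDissipation-19491; arbiter A28-11, the corner law; memo §30 (M1), (M3) by name).  For the line
`0 < a ≤ 1/16`, Bloch offset `|b| ≤ ½` and slot time `0 ≤ s ≤ 8`, the sources of the kink-sheet block in the frame of `…KHCornerFrame` are the
functionals `∫_{−½}^{½} F(y) e^{2πi(b+n)y} dy` of the profile modes with
* `F_U = (−G(¼−y)e^{−iπb/2} + G(−¼−y)e^{iπb/2})·e^{−2πias·tri(y)}` (ANTISYMMETRIC pair: pole-free, `…KHKernelBloch(Deriv)`),
* `F_V = (−G(¼−y)e^{−iπb/2} − G(−¼−y)e^{iπb/2})·e^{−2πias·tri(y)}` (symmetric pair: carries the pole `1/(4π²(a²+b²))` once).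
This file verifies the hypotheses of the Bloch duality (`…KHBlochDuality`: continuity, Bloch condition `F(½) = e^{−2πib}F(−½)`, derivative off
`{±¼}`, measurability, bounds; corner numerics `…KHCornerPhase`) and concludes
**`Σ_{n∈S} (a²+(b+n)²)|F̂_U(n)|² ≤ 2`** and **`Σ_{n∈S} (a²+(b+n)²)|F̂_V(n)|² ≤ 1/a²`** (`corner_sum_U_le`, `corner_sum_V_le`), i.e. by Cauchy–Schwarz the
`U`-source of any profile is `≤ √2·√(input energy)` and the `V`-source `≤ √(input energy)/a`, uniformly in the window and in `(a, b) → 0`.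
No definitions; no statement about the crux. [cite: Drazin2002, §8.3 (8.36)–(8.38)] [problem: turb]
-/

-- `Summit.<Summit>.<Problem>`: single-conjunct summit, the duplicate namespace segment is deliberate.
set_option linter.dupNamespace false

noncomputable section

namespace Summit.AnomalousDissipation.AnomalousDissipation.Theorems.SawtoothPulseCascade.K2PhaseBudget

open Set MeasureTheory intervalIntegral Literature.Analysis.FluidPDE.SawtoothCascade

/-! ## The two kink-pair sources: hypotheses of the Bloch duality, and the weighted Bessel sums -/

section sources

variable {a b : ℝ} {K G K' G' : ℝ → ℂ}

/-- **The antisymmetric source `F_U`: weighted Bessel sum `≤ 2`.** For `0 < a ≤ 1/16`, `|b| ≤ ½`, `0 ≤ s ≤ 8` and every finite set of modes,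
`Σ_{n∈S} (a²+(b+n)²)·|∫_{−½}^{½} (−G(¼−y)e^{−iπb/2} + G(−¼−y)e^{iπb/2}) e^{−2πias·tri(y)} e^{2πi(b+n)y} dy|² ≤ 2`. [cite: Drazin2002, §8.3 (8.36)–(8.38)] -/
theorem corner_sum_U_le (ha : 0 < a) (ha1 : a ≤ 1 / 16) (hb : |b| ≤ 1 / 2) {s : ℝ} (hs0 : 0 ≤ s) (hs : s ≤ 8)
    (hK : K = fun r : ℝ => (-((Real.exp (-(2 * Real.pi * a * r)) : ℂ) /
            (1 - starRingEnd ℂ (Complex.exp (2 * Real.pi * b * Complex.I)) * (Real.exp (-(2 * Real.pi * a)) : ℂ))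
          + (Real.exp (2 * Real.pi * a * (r - 1)) : ℂ) * Complex.exp (2 * Real.pi * b * Complex.I) /
            (1 - Complex.exp (2 * Real.pi * b * Complex.I) * (Real.exp (-(2 * Real.pi * a)) : ℂ))) /
        (2 * (2 * Real.pi * a) : ℂ)))
    (hG : ∀ u : ℝ, G u = Complex.exp (2 * Real.pi * b * (⌊u⌋ : ℝ) * Complex.I) * K (u - ⌊u⌋))
    (hK' : K' = fun r : ℝ => ((Real.exp (-(2 * Real.pi * a * r)) : ℂ) /
            (1 - starRingEnd ℂ (Complex.exp (2 * Real.pi * b * Complex.I)) * (Real.exp (-(2 * Real.pi * a)) : ℂ))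
          - (Real.exp (2 * Real.pi * a * (r - 1)) : ℂ) * Complex.exp (2 * Real.pi * b * Complex.I) /
            (1 - Complex.exp (2 * Real.pi * b * Complex.I) * (Real.exp (-(2 * Real.pi * a)) : ℂ))) / 2)
    (hG' : ∀ u : ℝ, G' u = Complex.exp (2 * Real.pi * b * (⌊u⌋ : ℝ) * Complex.I) * K' (u - ⌊u⌋)) (S : Finset ℤ) :
    ∑ n ∈ S, (a ^ 2 + (b + n) ^ 2) *
        ‖∫ y in (-(1 / 2 : ℝ))..(1 / 2),
            ((-G (1 / 4 - y) * Complex.exp (-((Real.pi * b / 2 : ℝ) : ℂ) * Complex.I) + G (-(1 / 4) - y) * Complex.exp (((Real.pi * b / 2 : ℝ) : ℂ) * Complex.I)) *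
              Complex.exp (-((2 * Real.pi * a * s * triWave y : ℝ) : ℂ) * Complex.I)) *
            Complex.exp ((2 * Real.pi * (b + n) * y : ℝ) * Complex.I)‖ ^ 2 ≤ 2 := by
  set ep : ℂ := Complex.exp (((Real.pi * b / 2 : ℝ) : ℂ) * Complex.I) with hep
  set em : ℂ := Complex.exp (-((Real.pi * b / 2 : ℝ) : ℂ) * Complex.I) with hem
  set N₁ : ℝ := ‖1 - Complex.exp (2 * Real.pi * b * Complex.I) * (Real.exp (-(2 * Real.pi * a)) : ℂ)‖ with hN₁
  have hπ := Real.pi_pos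
  have hepn : ‖ep‖ = 1 := Complex.norm_exp_ofReal_mul_I _
  have hemn : ‖em‖ = 1 := by
    rw [hem, show -((Real.pi * b / 2 : ℝ) : ℂ) * Complex.I = ((-(Real.pi * b / 2) : ℝ) : ℂ) * Complex.I by push_cast; ring]
    exact Complex.norm_exp_ofReal_mul_I _
  -- the phase, the kernel pair and their derivatives
  set φ : ℝ → ℂ := fun y => Complex.exp (-((2 * Real.pi * a * s * triWave y : ℝ) : ℂ) * Complex.I) with hφ
  set τ : ℝ → ℝ := fun y => if y ∈ Ioo (-(1 / 4 : ℝ)) (1 / 4) then (1 : ℝ) else -1 with hτ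
  set φ' : ℝ → ℂ := fun y => -(((2 * Real.pi * a * s * τ y : ℝ) : ℂ)) * Complex.I * φ y with hφ'
  set k : ℝ → ℂ := fun y => -G (1 / 4 - y) * em + G (-(1 / 4) - y) * ep with hk
  set k' : ℝ → ℂ := fun y => G' (1 / 4 - y) * em - G' (-(1 / 4) - y) * ep with hk'
  set F : ℝ → ℂ := fun y => k y * φ y with hF
  set F' : ℝ → ℂ := fun y => k' y * φ y + k y * φ' y with hF'
  have hφn : ∀ y, ‖φ y‖ = 1 := fun y => by
    rw [hφ]; dsimp only
    rw [show -((2 * Real.pi * a * s * triWave y : ℝ) : ℂ) * Complex.I = ((-(2 * Real.pi * a * s * triWave y) : ℝ) : ℂ) * Complex.I by push_cast; ring]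
    exact Complex.norm_exp_ofReal_mul_I _
  have hτ1 : ∀ y, |τ y| = 1 := fun y => by rw [hτ]; dsimp only; split_ifs <;> simp
  have hφ'n : ∀ y, ‖φ' y‖ = 2 * Real.pi * a * s := fun y => by
    rw [hφ']; dsimp only
    rw [norm_mul, norm_mul, norm_neg, Complex.norm_real, Complex.norm_I, hφn, mul_one, mul_one, Real.norm_eq_abs, abs_mul,
      abs_of_nonneg (by positivity : (0 : ℝ) ≤ 2 * Real.pi * a * s), hτ1, mul_one]
  -- kernel pair bounds (pole-free)
  have hkn : ∀ y, ‖k y‖ ≤ 2 / 3 := fun y => by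
    have h := norm_blochKernel_pair_sub_le ha hb hK hG (-(1 / 4) - y)
    rw [show -(1 / 4 : ℝ) - y + 1 / 2 = 1 / 4 - y by ring] at h
    rw [hk]; dsimp only
    rw [show -G (1 / 4 - y) * em + G (-(1 / 4) - y) * ep = -(G (1 / 4 - y) * em - G (-(1 / 4) - y) * ep) by ring, norm_neg]
    exact h
  have hk'n : ∀ y, ‖k' y‖ ≤ 2 := fun y => by
    have h := norm_blochKernelDeriv_pair_sub_le ha b hK' hG' (-(1 / 4) - y)
    rw [show -(1 / 4 : ℝ) - y + 1 / 2 = 1 / 4 - y by ring] at h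
    have hnum := corner_pair_numerics ha ha1 hb
    have hN : 0 < N₁ := lt_of_lt_of_le (by positivity) (pi_mul_le_norm_one_sub_zq ha ha1 b)
    rw [hk']; dsimp only
    refine h.trans ?_
    rw [div_le_iff₀ hN]
    linarith
  -- (i) continuity, (ii) bound
  have hGc : Continuous G := continuous_blochKernel ha b hK hG
  have hφc : Continuous φ := by rw [hφ]; have := continuous_triWave'; fun_prop
  have hkc : Continuous k := by rw [hk]; fun_prop
  have hFc : Continuous F := by rw [hF]; exact hkc.mul hφc
  have hFb : ∀ y, ‖F y‖ ≤ 1 := fun y => by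
    rw [hF]; dsimp only; rw [norm_mul, hφn, mul_one]; linarith [hkn y]
  -- (iii) derivative off the kinks
  have hd : ∀ y ∈ Ioo (-(1 / 2 : ℝ)) (1 / 2) \ ({-(1 / 4 : ℝ), 1 / 4} : Set ℝ), HasDerivAt F (F' y) y := by
    intro y hy
    have hτy := hasDerivAt_triWave_of_mem hy
    obtain ⟨⟨h1, h2⟩, hT⟩ := hy
    simp only [mem_insert_iff, mem_singleton_iff, not_or] at hT
    have hf1 : Int.fract (1 / 4 - y) ≠ 0 := fract_ne_zero_of_abs_lt_one (by linarith) (by linarith) (fun h => hT.2 (by linarith))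
    have hf2 : Int.fract (-(1 / 4) - y) ≠ 0 := fract_ne_zero_of_abs_lt_one (by linarith) (by linarith) (fun h => hT.1 (by linarith))
    have hG1 : HasDerivAt (fun y : ℝ => G (1 / 4 - y)) (-G' (1 / 4 - y)) y :=
      HasDerivAt.comp_const_sub (1 / 4) y (hasDerivAt_blochKernel ha b hK hG hK' hG' hf1)
    have hG2 : HasDerivAt (fun y : ℝ => G (-(1 / 4) - y)) (-G' (-(1 / 4) - y)) y :=
      HasDerivAt.comp_const_sub (-(1 / 4)) y (hasDerivAt_blochKernel ha b hK hG hK' hG' hf2)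
    have hkd : HasDerivAt k (k' y) y := by
      have h := ((hG1.neg.mul_const em).add (hG2.mul_const ep))
      rw [hk, hk']
      refine h.congr_deriv ?_
      ring
    have hφd : HasDerivAt φ (φ' y) y := by
      rw [hφ, hφ']
      exact hasDerivAt_transportExp hτy
    rw [hF, hF']
    exact hkd.mul hφd
  -- (iv) measurability of `F'`
  have hG'm : Measurable G' := measurable_blochKernelDeriv a b hK' hG'
  have hτm : Measurable τ := by
    rw [hτ]
    exact Measurable.ite measurableSet_Ioo measurable_const measurable_const
  have hF'm : Measurable F' := by
    have h1 : Measurable fun y : ℝ => G' (1 / 4 - y) := hG'm.comp (measurable_const.sub measurable_id)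
    have h2 : Measurable fun y : ℝ => G' (-(1 / 4) - y) := hG'm.comp (measurable_const.sub measurable_id)
    have hk'm : Measurable k' := by rw [hk']; exact (h1.mul measurable_const).sub (h2.mul measurable_const)
    have hφ'm : Measurable φ' := by
      rw [hφ']
      exact ((Complex.measurable_ofReal.comp (measurable_const.mul hτm)).neg.mul measurable_const).mul hφc.measurable
    rw [hF']
    exact (hk'm.mul hφc.measurable).add (hkc.measurable.mul hφ'm)
  -- (v) bound on `F'`: `‖k'‖ + ‖k‖·2πas ≤ 2 + (2/3)·π ≤ 5`
  have hb' : ∀ y, ‖F' y‖ ≤ 5 := fun y => by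
    rw [hF']; dsimp only
    have hπ4 := Real.pi_lt_four
    have has : a * s ≤ 1 / 16 * 8 := mul_le_mul ha1 hs hs0 (by norm_num)
    calc ‖k' y * φ y + k y * φ' y‖ ≤ ‖k' y‖ * ‖φ y‖ + ‖k y‖ * ‖φ' y‖ := by
          refine (norm_add_le _ _).trans ?_; rw [norm_mul, norm_mul]
      _ = ‖k' y‖ + ‖k y‖ * (2 * Real.pi * a * s) := by rw [hφn, hφ'n, mul_one]
      _ ≤ 2 + (2 / 3) * (2 * Real.pi * a * s) := add_le_add (hk'n y) (mul_le_mul_of_nonneg_right (hkn y) (by positivity))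
      _ ≤ 5 := by nlinarith
  -- (vi) the Bloch condition
  have hbloch : F (1 / 2) = Complex.exp (-((2 * Real.pi * b : ℝ) : ℂ) * Complex.I) * F (-(1 / 2)) := by
    have hφp : φ (1 / 2) = φ (-(1 / 2)) := by
      have ht : triWave (1 / 2) = triWave (-(1 / 2)) := by
        have := triWave_add_one (-(1 / 2)); norm_num at this; exact this
      rw [hφ]; dsimp only; rw [ht]
    have hG1 : G (1 / 4 - 1 / 2) = Complex.exp (-(2 * Real.pi * b * Complex.I)) * G (1 / 4 - -(1 / 2)) := by
      rw [show (1 / 4 : ℝ) - 1 / 2 = (1 / 4 - -(1 / 2)) - 1 by norm_num]; exact blochKernel_sub_one b hG _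
    have hG2 : G (-(1 / 4) - 1 / 2) = Complex.exp (-(2 * Real.pi * b * Complex.I)) * G (-(1 / 4) - -(1 / 2)) := by
      rw [show (-(1 / 4) : ℝ) - 1 / 2 = (-(1 / 4) - -(1 / 2)) - 1 by norm_num]; exact blochKernel_sub_one b hG _
    have hph : Complex.exp (-(2 * Real.pi * b * Complex.I)) = Complex.exp (-((2 * Real.pi * b : ℝ) : ℂ) * Complex.I) := by
      congr 1; push_cast; ring
    rw [hF]; dsimp only; rw [hk]; dsimp only
    rw [hφp, hG1, hG2, hph]
    ring
  -- assemble
  have hmain := sum_weight_sq_coeff_le_pos (T := ({-(1 / 4 : ℝ), 1 / 4} : Set ℝ)) ((Set.finite_singleton _).insert _ |>.countable)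
    hFc.continuousOn hFb hd hF'm.aestronglyMeasurable hb' hbloch a S
  have hI1 : (∫ y in (-(1 / 2 : ℝ))..(1 / 2), ‖F y‖ ^ 2) ≤ 1 := by
    have h := intervalIntegral.norm_integral_le_of_norm_le_const (a := -(1 / 2 : ℝ)) (b := 1 / 2) (C := 1) (f := fun y => ‖F y‖ ^ 2)
      (fun y _ => by rw [Real.norm_eq_abs, abs_of_nonneg (by positivity)]; nlinarith [hFb y, norm_nonneg (F y)])
    have : |(1 / 2 : ℝ) - -(1 / 2)| = 1 := by norm_num
    rw [this, mul_one] at h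
    exact (Real.le_norm_self _).trans h
  have hI2 : (∫ y in (-(1 / 2 : ℝ))..(1 / 2), ‖F' y‖ ^ 2) ≤ 25 := by
    have h := intervalIntegral.norm_integral_le_of_norm_le_const (a := -(1 / 2 : ℝ)) (b := 1 / 2) (C := 25) (f := fun y => ‖F' y‖ ^ 2)
      (fun y _ => by rw [Real.norm_eq_abs, abs_of_nonneg (by positivity)]; nlinarith [hb' y, norm_nonneg (F' y)])
    have : |(1 / 2 : ℝ) - -(1 / 2)| = 1 := by norm_num
    rw [this, mul_one] at h
    exact (Real.le_norm_self _).trans h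
  have hπ3 := Real.pi_gt_three
  have ha2 : a ^ 2 ≤ 1 := by nlinarith
  have h4 : 1 / (4 * Real.pi ^ 2) * (∫ y in (-(1 / 2 : ℝ))..(1 / 2), ‖F' y‖ ^ 2) ≤ 1 / 36 * 25 := by
    apply mul_le_mul _ hI2 _ (by positivity)
    · rw [div_le_div_iff₀ (by positivity) (by norm_num)]; nlinarith
    · have h := intervalIntegral.integral_nonneg (μ := volume) (f := fun y => ‖F' y‖ ^ 2) (by norm_num : (-(1 / 2 : ℝ)) ≤ 1 / 2)
        (fun y _ => by positivity)
      exact h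
  have hFeq : ∀ n : ℤ, (∫ y in (-(1 / 2 : ℝ))..(1 / 2), F y * Complex.exp ((2 * Real.pi * (b + n) * y : ℝ) * Complex.I)) =
      ∫ y in (-(1 / 2 : ℝ))..(1 / 2), ((-G (1 / 4 - y) * em + G (-(1 / 4) - y) * ep) *
        Complex.exp (-((2 * Real.pi * a * s * triWave y : ℝ) : ℂ) * Complex.I)) * Complex.exp ((2 * Real.pi * (b + n) * y : ℝ) * Complex.I) := by
    intro n; rfl
  simp_rw [hFeq] at hmain
  refine hmain.trans ?_
  nlinarith [mul_le_mul_of_nonneg_left hI1 (sq_nonneg a)]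

/-- **The symmetric source `F_V`: weighted Bessel sum `≤ 1/a²`.** For `0 < a ≤ 1/16`, `|b| ≤ ½`, `0 ≤ s ≤ 8` and every finite set of modes,
`Σ_{n∈S} (a²+(b+n)²)·|∫_{−½}^{½} (−G(¼−y)e^{−iπb/2} − G(−¼−y)e^{iπb/2}) e^{−2πias·tri(y)} e^{2πi(b+n)y} dy|² ≤ 1/a²`. [cite: Drazin2002, §8.3 (8.36)–(8.38)] -/
theorem corner_sum_V_le (ha : 0 < a) (ha1 : a ≤ 1 / 16) (hb : |b| ≤ 1 / 2) {s : ℝ} (hs0 : 0 ≤ s) (hs : s ≤ 8)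
    (hK : K = fun r : ℝ => (-((Real.exp (-(2 * Real.pi * a * r)) : ℂ) /
            (1 - starRingEnd ℂ (Complex.exp (2 * Real.pi * b * Complex.I)) * (Real.exp (-(2 * Real.pi * a)) : ℂ))
          + (Real.exp (2 * Real.pi * a * (r - 1)) : ℂ) * Complex.exp (2 * Real.pi * b * Complex.I) /
            (1 - Complex.exp (2 * Real.pi * b * Complex.I) * (Real.exp (-(2 * Real.pi * a)) : ℂ))) /
        (2 * (2 * Real.pi * a) : ℂ)))
    (hG : ∀ u : ℝ, G u = Complex.exp (2 * Real.pi * b * (⌊u⌋ : ℝ) * Complex.I) * K (u - ⌊u⌋))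
    (hK' : K' = fun r : ℝ => ((Real.exp (-(2 * Real.pi * a * r)) : ℂ) /
            (1 - starRingEnd ℂ (Complex.exp (2 * Real.pi * b * Complex.I)) * (Real.exp (-(2 * Real.pi * a)) : ℂ))
          - (Real.exp (2 * Real.pi * a * (r - 1)) : ℂ) * Complex.exp (2 * Real.pi * b * Complex.I) /
            (1 - Complex.exp (2 * Real.pi * b * Complex.I) * (Real.exp (-(2 * Real.pi * a)) : ℂ))) / 2)
    (hG' : ∀ u : ℝ, G' u = Complex.exp (2 * Real.pi * b * (⌊u⌋ : ℝ) * Complex.I) * K' (u - ⌊u⌋)) (S : Finset ℤ) :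
    ∑ n ∈ S, (a ^ 2 + (b + n) ^ 2) *
        ‖∫ y in (-(1 / 2 : ℝ))..(1 / 2),
            ((-G (1 / 4 - y) * Complex.exp (-((Real.pi * b / 2 : ℝ) : ℂ) * Complex.I) - G (-(1 / 4) - y) * Complex.exp (((Real.pi * b / 2 : ℝ) : ℂ) * Complex.I)) *
              Complex.exp (-((2 * Real.pi * a * s * triWave y : ℝ) : ℂ) * Complex.I)) *
            Complex.exp ((2 * Real.pi * (b + n) * y : ℝ) * Complex.I)‖ ^ 2 ≤ 1 / a ^ 2 := by
  set ep : ℂ := Complex.exp (((Real.pi * b / 2 : ℝ) : ℂ) * Complex.I) with hep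
  set em : ℂ := Complex.exp (-((Real.pi * b / 2 : ℝ) : ℂ) * Complex.I) with hem
  set N₁ : ℝ := ‖1 - Complex.exp (2 * Real.pi * b * Complex.I) * (Real.exp (-(2 * Real.pi * a)) : ℂ)‖ with hN₁
  have hπ := Real.pi_pos
  have hπ3 := Real.pi_gt_three
  have hπ4 := Real.pi_lt_four
  have hepn : ‖ep‖ = 1 := Complex.norm_exp_ofReal_mul_I _
  have hemn : ‖em‖ = 1 := by
    rw [hem, show -((Real.pi * b / 2 : ℝ) : ℂ) * Complex.I = ((-(Real.pi * b / 2) : ℝ) : ℂ) * Complex.I by push_cast; ring]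
    exact Complex.norm_exp_ofReal_mul_I _
  have hN : Real.pi * a ≤ N₁ := pi_mul_le_norm_one_sub_zq ha ha1 b
  have hNpos : 0 < N₁ := lt_of_lt_of_le (by positivity) hN
  set φ : ℝ → ℂ := fun y => Complex.exp (-((2 * Real.pi * a * s * triWave y : ℝ) : ℂ) * Complex.I) with hφ
  set τ : ℝ → ℝ := fun y => if y ∈ Ioo (-(1 / 4 : ℝ)) (1 / 4) then (1 : ℝ) else -1 with hτ
  set φ' : ℝ → ℂ := fun y => -(((2 * Real.pi * a * s * τ y : ℝ) : ℂ)) * Complex.I * φ y with hφ'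
  set k : ℝ → ℂ := fun y => -G (1 / 4 - y) * em - G (-(1 / 4) - y) * ep with hk
  set k' : ℝ → ℂ := fun y => G' (1 / 4 - y) * em + G' (-(1 / 4) - y) * ep with hk'
  set F : ℝ → ℂ := fun y => k y * φ y with hF
  set F' : ℝ → ℂ := fun y => k' y * φ y + k y * φ' y with hF'
  have hφn : ∀ y, ‖φ y‖ = 1 := fun y => by
    rw [hφ]; dsimp only
    rw [show -((2 * Real.pi * a * s * triWave y : ℝ) : ℂ) * Complex.I = ((-(2 * Real.pi * a * s * triWave y) : ℝ) : ℂ) * Complex.I by push_cast; ring]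
    exact Complex.norm_exp_ofReal_mul_I _
  have hτ1 : ∀ y, |τ y| = 1 := fun y => by rw [hτ]; dsimp only; split_ifs <;> simp
  have hφ'n : ∀ y, ‖φ' y‖ = 2 * Real.pi * a * s := fun y => by
    rw [hφ']; dsimp only
    rw [norm_mul, norm_mul, norm_neg, Complex.norm_real, Complex.norm_I, hφn, mul_one, mul_one, Real.norm_eq_abs, abs_mul,
      abs_of_nonneg (by positivity : (0 : ℝ) ≤ 2 * Real.pi * a * s), hτ1, mul_one]
  -- the pole: `2/(4π²(a²+b²)) + 2/3 ≤ 1/(16a²)` for `a ≤ 1/16`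
  have hpole : 2 * (1 / (4 * Real.pi ^ 2 * (a ^ 2 + b ^ 2))) + 2 / 3 ≤ 1 / (16 * a ^ 2) := by
    have h1 : 2 * (1 / (4 * Real.pi ^ 2 * (a ^ 2 + b ^ 2))) ≤ 1 / (18 * a ^ 2) := by
      rw [mul_one_div, div_le_div_iff₀ (by positivity) (by positivity)]
      nlinarith [sq_nonneg b, mul_pos (by positivity : (0 : ℝ) < a ^ 2) (by nlinarith : (0 : ℝ) < Real.pi ^ 2 - 9)]
    have h2 : 2 / 3 ≤ 1 / (16 * a ^ 2) - 1 / (18 * a ^ 2) := by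
      rw [show 1 / (16 * a ^ 2) - 1 / (18 * a ^ 2) = 1 / (144 * a ^ 2) by field_simp; ring]
      rw [div_le_div_iff₀ (by norm_num) (by positivity)]
      nlinarith
    linarith
  have hkn : ∀ y, ‖k y‖ ≤ 1 / (16 * a ^ 2) := fun y => by
    have h := norm_blochKernel_pair_add_le ha hb hK hG (-(1 / 4) - y)
    rw [show -(1 / 4 : ℝ) - y + 1 / 2 = 1 / 4 - y by ring] at h
    rw [hk]; dsimp only
    rw [show -G (1 / 4 - y) * em - G (-(1 / 4) - y) * ep = -(G (1 / 4 - y) * em + G (-(1 / 4) - y) * ep) by ring, norm_neg]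
    exact h.trans hpole
  have hk'n : ∀ y, ‖k' y‖ ≤ 2 / (Real.pi * a) := fun y => by
    rw [hk']; dsimp only
    have h1 := norm_blochKernelDeriv_le ha b hK' hG' (1 / 4 - y)
    have h2 := norm_blochKernelDeriv_le ha b hK' hG' (-(1 / 4) - y)
    calc ‖G' (1 / 4 - y) * em + G' (-(1 / 4) - y) * ep‖ ≤ ‖G' (1 / 4 - y)‖ * ‖em‖ + ‖G' (-(1 / 4) - y)‖ * ‖ep‖ := by
          refine (norm_add_le _ _).trans ?_; rw [norm_mul, norm_mul]
      _ ≤ 1 / N₁ * 1 + 1 / N₁ * 1 := by rw [hemn, hepn]; gcongr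
      _ = 2 / N₁ := by ring
      _ ≤ 2 / (Real.pi * a) := div_le_div_of_nonneg_left (by norm_num) (by positivity) hN
  have hGc : Continuous G := continuous_blochKernel ha b hK hG
  have hφc : Continuous φ := by rw [hφ]; have := continuous_triWave'; fun_prop
  have hkc : Continuous k := by rw [hk]; fun_prop
  have hFc : Continuous F := by rw [hF]; exact hkc.mul hφc
  have hFb : ∀ y, ‖F y‖ ≤ 1 / (16 * a ^ 2) := fun y => by
    rw [hF]; dsimp only; rw [norm_mul, hφn, mul_one]; exact hkn y
  have hd : ∀ y ∈ Ioo (-(1 / 2 : ℝ)) (1 / 2) \ ({-(1 / 4 : ℝ), 1 / 4} : Set ℝ), HasDerivAt F (F' y) y := by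
    intro y hy
    have hτy := hasDerivAt_triWave_of_mem hy
    obtain ⟨⟨h1, h2⟩, hT⟩ := hy
    simp only [mem_insert_iff, mem_singleton_iff, not_or] at hT
    have hf1 : Int.fract (1 / 4 - y) ≠ 0 := fract_ne_zero_of_abs_lt_one (by linarith) (by linarith) (fun h => hT.2 (by linarith))
    have hf2 : Int.fract (-(1 / 4) - y) ≠ 0 := fract_ne_zero_of_abs_lt_one (by linarith) (by linarith) (fun h => hT.1 (by linarith))
    have hG1 : HasDerivAt (fun y : ℝ => G (1 / 4 - y)) (-G' (1 / 4 - y)) y :=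
      HasDerivAt.comp_const_sub (1 / 4) y (hasDerivAt_blochKernel ha b hK hG hK' hG' hf1)
    have hG2 : HasDerivAt (fun y : ℝ => G (-(1 / 4) - y)) (-G' (-(1 / 4) - y)) y :=
      HasDerivAt.comp_const_sub (-(1 / 4)) y (hasDerivAt_blochKernel ha b hK hG hK' hG' hf2)
    have hkd : HasDerivAt k (k' y) y := by
      have h := ((hG1.neg.mul_const em).sub (hG2.mul_const ep))
      rw [hk, hk']
      refine h.congr_deriv ?_
      ring
    have hφd : HasDerivAt φ (φ' y) y := by
      rw [hφ, hφ']
      exact hasDerivAt_transportExp hτy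
    rw [hF, hF']
    exact hkd.mul hφd
  have hG'm : Measurable G' := measurable_blochKernelDeriv a b hK' hG'
  have hτm : Measurable τ := by
    rw [hτ]
    exact Measurable.ite measurableSet_Ioo measurable_const measurable_const
  have hF'm : Measurable F' := by
    have h1 : Measurable fun y : ℝ => G' (1 / 4 - y) := hG'm.comp (measurable_const.sub measurable_id)
    have h2 : Measurable fun y : ℝ => G' (-(1 / 4) - y) := hG'm.comp (measurable_const.sub measurable_id)
    have hk'm : Measurable k' := by rw [hk']; exact (h1.mul measurable_const).add (h2.mul measurable_const)
    have hφ'm : Measurable φ' := by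
      rw [hφ']
      exact ((Complex.measurable_ofReal.comp (measurable_const.mul hτm)).neg.mul measurable_const).mul hφc.measurable
    rw [hF']
    exact (hk'm.mul hφc.measurable).add (hkc.measurable.mul hφ'm)
  -- `‖F'‖ ≤ 2/(πa) + (1/(16a²))·2πas ≤ 4/a`
  have hb' : ∀ y, ‖F' y‖ ≤ 4 / a := fun y => by
    rw [hF']; dsimp only
    calc ‖k' y * φ y + k y * φ' y‖ ≤ ‖k' y‖ * ‖φ y‖ + ‖k y‖ * ‖φ' y‖ := by
          refine (norm_add_le _ _).trans ?_; rw [norm_mul, norm_mul]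
      _ = ‖k' y‖ + ‖k y‖ * (2 * Real.pi * a * s) := by rw [hφn, hφ'n, mul_one]
      _ ≤ 2 / (Real.pi * a) + 1 / (16 * a ^ 2) * (2 * Real.pi * a * s) :=
          add_le_add (hk'n y) (mul_le_mul_of_nonneg_right (hkn y) (by positivity))
      _ = (2 / Real.pi + Real.pi * s / 8) / a := by field_simp; ring
      _ ≤ 4 / a := by
          apply div_le_div_of_nonneg_right _ ha.le
          have h1 : 2 / Real.pi ≤ 2 / 3 := div_le_div_of_nonneg_left (by norm_num) (by norm_num) hπ3.le
          have h2 : Real.pi * s ≤ 3.15 * 8 := mul_le_mul Real.pi_lt_d2.le hs hs0 (by norm_num)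
          linarith
  have hbloch : F (1 / 2) = Complex.exp (-((2 * Real.pi * b : ℝ) : ℂ) * Complex.I) * F (-(1 / 2)) := by
    have hφp : φ (1 / 2) = φ (-(1 / 2)) := by
      have ht : triWave (1 / 2) = triWave (-(1 / 2)) := by
        have := triWave_add_one (-(1 / 2)); norm_num at this; exact this
      rw [hφ]; dsimp only; rw [ht]
    have hG1 : G (1 / 4 - 1 / 2) = Complex.exp (-(2 * Real.pi * b * Complex.I)) * G (1 / 4 - -(1 / 2)) := by
      rw [show (1 / 4 : ℝ) - 1 / 2 = (1 / 4 - -(1 / 2)) - 1 by norm_num]; exact blochKernel_sub_one b hG _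
    have hG2 : G (-(1 / 4) - 1 / 2) = Complex.exp (-(2 * Real.pi * b * Complex.I)) * G (-(1 / 4) - -(1 / 2)) := by
      rw [show (-(1 / 4) : ℝ) - 1 / 2 = (-(1 / 4) - -(1 / 2)) - 1 by norm_num]; exact blochKernel_sub_one b hG _
    have hph : Complex.exp (-(2 * Real.pi * b * Complex.I)) = Complex.exp (-((2 * Real.pi * b : ℝ) : ℂ) * Complex.I) := by
      congr 1; push_cast; ring
    rw [hF]; dsimp only; rw [hk]; dsimp only
    rw [hφp, hG1, hG2, hph]
    ring
  have hmain := sum_weight_sq_coeff_le_pos (T := ({-(1 / 4 : ℝ), 1 / 4} : Set ℝ)) ((Set.finite_singleton _).insert _ |>.countable)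
    hFc.continuousOn hFb hd hF'm.aestronglyMeasurable hb' hbloch a S
  have hI1 : (∫ y in (-(1 / 2 : ℝ))..(1 / 2), ‖F y‖ ^ 2) ≤ (1 / (16 * a ^ 2)) ^ 2 := by
    have h := intervalIntegral.norm_integral_le_of_norm_le_const (a := -(1 / 2 : ℝ)) (b := 1 / 2) (C := (1 / (16 * a ^ 2)) ^ 2) (f := fun y => ‖F y‖ ^ 2)
      (fun y _ => by
        rw [Real.norm_eq_abs, abs_of_nonneg (by positivity)]
        exact pow_le_pow_left₀ (norm_nonneg _) (hFb y) 2)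
    have : |(1 / 2 : ℝ) - -(1 / 2)| = 1 := by norm_num
    rw [this, mul_one] at h
    exact (Real.le_norm_self _).trans h
  have hI2 : (∫ y in (-(1 / 2 : ℝ))..(1 / 2), ‖F' y‖ ^ 2) ≤ (4 / a) ^ 2 := by
    have h := intervalIntegral.norm_integral_le_of_norm_le_const (a := -(1 / 2 : ℝ)) (b := 1 / 2) (C := (4 / a) ^ 2) (f := fun y => ‖F' y‖ ^ 2)
      (fun y _ => by
        rw [Real.norm_eq_abs, abs_of_nonneg (by positivity)]
        exact pow_le_pow_left₀ (norm_nonneg _) (hb' y) 2)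
    have : |(1 / 2 : ℝ) - -(1 / 2)| = 1 := by norm_num
    rw [this, mul_one] at h
    exact (Real.le_norm_self _).trans h
  have hFeq : ∀ n : ℤ, (∫ y in (-(1 / 2 : ℝ))..(1 / 2), F y * Complex.exp ((2 * Real.pi * (b + n) * y : ℝ) * Complex.I)) =
      ∫ y in (-(1 / 2 : ℝ))..(1 / 2), ((-G (1 / 4 - y) * em - G (-(1 / 4) - y) * ep) *
        Complex.exp (-((2 * Real.pi * a * s * triWave y : ℝ) : ℂ) * Complex.I)) * Complex.exp ((2 * Real.pi * (b + n) * y : ℝ) * Complex.I) := by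
    intro n; rfl
  simp_rw [hFeq] at hmain
  refine hmain.trans ?_
  -- `a²/(256a⁴) + (16/a²)/(4π²) ≤ 1/a²`
  have ha0 : 0 < a ^ 2 := by positivity
  have e1 : a ^ 2 * (∫ y in (-(1 / 2 : ℝ))..(1 / 2), ‖F y‖ ^ 2) ≤ 1 / (256 * a ^ 2) := by
    refine (mul_le_mul_of_nonneg_left hI1 ha0.le).trans (le_of_eq ?_)
    field_simp; ring
  have e2 : 1 / (4 * Real.pi ^ 2) * (∫ y in (-(1 / 2 : ℝ))..(1 / 2), ‖F' y‖ ^ 2) ≤ 1 / 36 * (16 / a ^ 2) := by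
    apply mul_le_mul _ (hI2.trans (le_of_eq (by rw [div_pow]; norm_num))) _ (by positivity)
    · rw [div_le_div_iff₀ (by positivity) (by norm_num)]; nlinarith
    · exact intervalIntegral.integral_nonneg (μ := volume) (f := fun y => ‖F' y‖ ^ 2) (by norm_num : (-(1 / 2 : ℝ)) ≤ 1 / 2) (fun y _ => by positivity)
  have e3 : 1 / (256 * a ^ 2) + 1 / 36 * (16 / a ^ 2) ≤ 1 / a ^ 2 := by
    rw [show 1 / (256 * a ^ 2) + 1 / 36 * (16 / a ^ 2) = (1 / 256 + 16 / 36) / a ^ 2 by field_simp]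
    exact div_le_div_of_nonneg_right (by norm_num) ha0.le
  linarith

end sources

end Summit.AnomalousDissipation.AnomalousDissipation.Theorems.SawtoothPulseCascade.K2PhaseBudget

end
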